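import Literature.Geometry.Riemannian.RicciFlowConjugateHeatKernel
import Literature.Geometry.Riemannian.NashEntropy
import Literature.Geometry.Riemannian.HeatKernelDuality
import HarnessLib

/-!
# The pointed Nash entropy of the conjugate heat KERNEL (Bamler 2020a, Def. 5.1, Prop. 5.2),
# away from the pole

R. Bamler, *Entropy and heat kernel bounds on a Ricci flow background*, arXiv:2008.07093 (2020a),
§5.1: for the conjugate heat kernel `dν_{x₀,t₀;t} = K(x₀,t₀;·,t) dg_t = (4πτ)^{-n/2} e^{-f} dg_t`,
`τ = t₀ − t`, the pointed Nash entropy is `𝒩_{x₀,t₀}(τ) = ∫ f dν − n/2` (Def. 5.1) and Prop. 5.2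
states `d/dτ(τ𝒩) = 𝒲 ≤ 0`-type identities and the concavity of `τ𝒩(τ)`.

`NashEntropy.lean` proves Prop. 5.2 for conjugate heat flows of smooth positive probability
densities on a flow interval `[0, T']`. The tree now has the conjugate heat kernel
`K = K(x₀,t₀;·,·)` of a Ricci flow on a closed manifold (`IsRicciFlow.exists_conjugateHeatKernel`,
positivity `IsRicciFlow.exists_conjugateHeatKernel_family_pos`): `C^∞` and positive on
`M × (a, t₀)`, the density of `ν_{x₀,t₀;s}`, solving `∂ₛK = −ΔK + RK`. This file transfers
Prop. 5.2 to the kernel on every compact sub-interval `[r₁, r₂] ⊂ (a, t₀)` (time translation):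

* `isConjugateHeatSolutionOn_of_kernel` — `(r, y) ↦ K (y, r)` is a conjugate heat solution on
  `[r₁, r₂]`; `integral_kernel_eq_one` — unit mass.
* `IsConjugateHeatSolutionOn.comp_add_const`, `entropyPotential_comp_add_const`,
  `pointedNashEntropy_comp_add_const` — time translation.
* `IsRicciFlow.mul_kernelNashEntropy_sub_eq_integral` —
  `(t₀ − r₁)𝒩(r₁) − (t₀ − r₂)𝒩(r₂) = ∫_{r₁}^{r₂} 𝒲 ds` (Prop. 5.2, first identity, integrated);
* `IsRicciFlow.monotoneOn_kernelWEntropy` — `s ↦ 𝒲(s)` is non-decreasing on `(a, t₀)`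
  (Prop. 5.2, second identity, integrated);
* `IsRicciFlow.mul_kernelWEntropy_le`, `IsRicciFlow.le_mul_kernelWEntropy` — concavity sandwich;
* `IsRicciFlow.mul_kernelNashEntropy_add_mul_le` — the entropy floor (display after Prop. 5.2).

Here `𝒩(r) = pointedNashEntropy h (fun r y ↦ K (y, r)) m t₀ r` (`= 𝒩_{x₀,t₀}(t₀ − r)`) and
`𝒲(s) = 𝒲[h(s), f(s), t₀ − s]`. What is NOT here: the behaviour at the pole `r → t₀`
(`τ𝒩(τ) → 0`), which needs heat kernel asymptotics. Everything is proved; no definitions, no named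
facts.

## References

* R. H. Bamler, *Entropy and heat kernel bounds on a Ricci flow background*, arXiv:2008.07093
  (2020), §5.1, Def. 5.1, Prop. 5.2. [Bamler2020Entropy]
-/

noncomputable section

open Bundle Set Function Filter Manifold MeasureTheory Measure TopologicalSpace
open scoped Manifold ContDiff Topology ENNReal NNReal

namespace Literature.Geometry.Riemannian

open Lorentzian Lorentzian.PseudoRiemannianMetric

section Kernel

variable {m : ℕ} {H : Type*} [TopologicalSpace H]
  {I : ModelWithCorners ℝ (EuclideanSpace ℝ (Fin m)) H} [I.Boundaryless]
  {M : Type*} [TopologicalSpace M] [ChartedSpace H M] [IsManifold I ∞ M]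
  [T2Space M] [CompactSpace M] [SecondCountableTopology M] [MeasurableSpace M] [BorelSpace M]
  {h : ℝ → PseudoRiemannianMetric I ∞ (EuclideanSpace ℝ (Fin m)) (TangentSpace I : M → Type _)}
  {cov : ℝ → CovariantDerivative I (EuclideanSpace ℝ (Fin m)) (TangentSpace I : M → Type _)}
  (hh : IsContMDiffFamilyOn ∞ h univ) (hR : ∀ r, (h r).IsRiemannian)

omit [I.Boundaryless] [T2Space M] [CompactSpace M] [SecondCountableTopology M] [MeasurableSpace M]
  [BorelSpace M] in
/-- Time translation of conjugate heat solutions, forward form: if `u` solves `□*u = 0` for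
`(h, cov)` on `[a, b]`, `a < b`, then `r ↦ u (r + c)` solves it for the translated flow
`r ↦ (h (r + c), cov (r + c))` on `[a − c, b − c]`. [folklore] -/
theorem IsConjugateHeatSolutionOn.comp_add_const {a b : ℝ} (hab : a < b) (c : ℝ) {u : ℝ → M → ℝ}
    (hu : IsConjugateHeatSolutionOn h cov (Icc a b) u) :
    IsConjugateHeatSolutionOn (fun r ↦ h (r + c)) (fun r ↦ cov (r + c)) (Icc (a - c) (b - c))
      (fun r ↦ u (r + c)) := by
  refine ⟨?_, fun r hr x ↦ ?_⟩
  · have hφ : ContMDiff (I.prod 𝓘(ℝ, ℝ)) (I.prod 𝓘(ℝ, ℝ)) ∞ (fun p : M × ℝ ↦ (p.1, p.2 + c)) :=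
      contMDiff_fst.prodMk (contMDiff_snd.add contMDiff_const)
    refine hu.1.comp hφ.contMDiffOn ?_
    rintro ⟨x, r⟩ ⟨-, hr⟩
    exact ⟨mem_univ _, by linarith [hr.1], by linarith [hr.2]⟩
  · have hr' : r + c ∈ Icc a b := ⟨by linarith [hr.1], by linarith [hr.2]⟩
    have hab' : a - c < b - c := by linarith
    have hU : UniqueDiffOn ℝ (Icc a b) := uniqueDiffOn_Icc hab
    have hU' : UniqueDiffOn ℝ (Icc (a - c) (b - c)) := uniqueDiffOn_Icc hab'
    have h1 : HasDerivWithinAt (fun r'' ↦ u r'' x) (derivWithin (fun r'' ↦ u r'' x) (Icc a b) (r + c))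
        (Icc a b) (r + c) := hasDerivWithinAt_time_of_contMDiffOn (by simp) hu.1 x hr'
    have h2 : HasDerivWithinAt (fun r' : ℝ ↦ r' + c) 1 (Icc (a - c) (b - c)) r :=
      (hasDerivWithinAt_id r _).add_const c
    have hmaps : MapsTo (fun r' : ℝ ↦ r' + c) (Icc (a - c) (b - c)) (Icc a b) :=
      fun r' hr' ↦ ⟨by linarith [hr'.1], by linarith [hr'.2]⟩
    have h3 := h1.comp r h2 hmaps
    rw [mul_one] at h3
    rw [show (fun r' ↦ u (r' + c) x) = (fun r'' ↦ u r'' x) ∘ (fun r' : ℝ ↦ r' + c) from rfl,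
      h3.derivWithin (hU' r hr), hu.2 (r + c) hr' x]

/-- Time translation of the entropy potential: `f` for `r ↦ u (r + c)` based at `τ₀ − c`, at time
`t`, is `f` for `u` based at `τ₀`, at time `t + c`. [folklore] -/
theorem entropyPotential_comp_add_const {X : Type*} (u : ℝ → X → ℝ) (n : ℕ) (τ₀ c t : ℝ) :
    entropyPotential (fun r ↦ u (r + c)) n (τ₀ - c) t = entropyPotential u n τ₀ (t + c) := by
  funext x
  simp only [entropyPotential_apply]
  rw [show τ₀ - c - t = τ₀ - (t + c) by ring]

omit [I.Boundaryless] [SecondCountableTopology M] in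
/-- Time translation of the pointed Nash entropy. [folklore] -/
theorem pointedNashEntropy_comp_add_const (u : ℝ → M → ℝ) (n : ℕ) (τ₀ c t : ℝ) :
    pointedNashEntropy (fun r ↦ h (r + c)) (fun r ↦ u (r + c)) n (τ₀ - c) t =
      pointedNashEntropy h u n τ₀ (t + c) := by
  rw [pointedNashEntropy_def, pointedNashEntropy_def, entropyPotential_comp_add_const]


omit [T2Space M] [CompactSpace M] [SecondCountableTopology M] [MeasurableSpace M] [BorelSpace M]
  [I.Boundaryless] in
/-- **The conjugate heat kernel is a conjugate heat solution on compact sub-intervals**: if `K`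
(`= K(x₀,t₀;·,·)`) is `C^∞` on `M × (a, t₀)` with `∂ₛK = −Δ_{h(s)}K + R K` there
(`IsRicciFlow.exists_conjugateHeatKernel`), then `(r, y) ↦ K (y, r)` is an
`IsConjugateHeatSolutionOn h cov (Icc r₁ r₂)` for `a < r₁ < r₂ < t₀`. [cite: Bamler2020Entropy, §2.3] -/
theorem isConjugateHeatSolutionOn_of_kernel {a t₀ : ℝ} {K : M × ℝ → ℝ}
    (hKs : ContMDiffOn (I.prod 𝓘(ℝ, ℝ)) 𝓘(ℝ, ℝ) ∞ K (univ ×ˢ Ioo a t₀))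
    (hKpde : ∀ p ∈ univ ×ˢ Ioo a t₀, deriv (fun s ↦ K (p.1, s)) p.2 =
      -(h p.2).laplaceBeltrami (fun y ↦ K (y, p.2)) p.1 +
        (h p.2).scalarCurvatureWith (cov p.2) p.1 * K p)
    {r₁ r₂ : ℝ} (har₁ : a < r₁) (h12 : r₁ < r₂) (hr₂ : r₂ < t₀) :
    IsConjugateHeatSolutionOn h cov (Icc r₁ r₂) fun r y ↦ K (y, r) := by
  have hsub : (univ : Set M) ×ˢ Icc r₁ r₂ ⊆ univ ×ˢ Ioo a t₀ :=
    prod_mono le_rfl fun r hr ↦ ⟨har₁.trans_le hr.1, hr.2.trans_lt hr₂⟩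
  refine ⟨(hKs.mono hsub).congr fun p _ ↦ by simp, fun r hr x ↦ ?_⟩
  have hO : IsOpen ((univ : Set M) ×ˢ Ioo a t₀) := isOpen_univ.prod isOpen_Ioo
  have hxr : (x, r) ∈ (univ : Set M) ×ˢ Ioo a t₀ := hsub ⟨mem_univ _, hr⟩
  have hcurve : ContMDiffAt 𝓘(ℝ, ℝ) 𝓘(ℝ, ℝ) ∞ (fun s ↦ K (x, s)) r :=
    (hKs.contMDiffAt (hO.mem_nhds hxr)).comp r (contMDiffAt_const.prodMk contMDiffAt_id)
  have hdiff : DifferentiableAt ℝ (fun s ↦ K (x, s)) r :=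
    (contMDiffAt_iff_contDiffAt.1 hcurve).differentiableAt (by simp)
  show derivWithin (fun s ↦ K (x, s)) (Icc r₁ r₂) r = _
  rw [hdiff.derivWithin (uniqueDiffOn_Icc h12 r hr)]
  exact hKpde (x, r) hxr

include hh hR in
/-- **The conjugate heat kernel has unit mass**: `∫ K (y, r) dV_{h(r)}(y) = 1` for `r ∈ (a, t₀)`
(`ν_{x₀,t₀;r}` is a probability measure with density `K (·, r)`). [cite: Bamler2020Entropy, §2.3] -/
theorem integral_kernel_eq_one {a t₀ : ℝ} {x₀ : M} {K : M × ℝ → ℝ}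
    (hKs : ContMDiffOn (I.prod 𝓘(ℝ, ℝ)) 𝓘(ℝ, ℝ) ∞ K (univ ×ˢ Ioo a t₀))
    (hK0 : ∀ p ∈ univ ×ˢ Ioo a t₀, 0 ≤ K p)
    (hKν : ∀ s ∈ Ioo a t₀, heatKernelMeasure hh hR t₀ x₀ s =
      (h s).riemVolume.withDensity fun y ↦ ENNReal.ofReal (K (y, s)))
    {r : ℝ} (hr : r ∈ Ioo a t₀) : ∫ y, K (y, r) ∂(h r).riemVolume = 1 := by
  have hc : Continuous fun y ↦ K (y, r) :=
    hKs.continuousOn.comp_continuous (continuous_id.prodMk continuous_const)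
      fun _ ↦ ⟨mem_univ _, hr⟩
  have h1 : heatKernelMeasure hh hR t₀ x₀ r univ = 1 := measure_univ
  rw [hKν r hr, withDensity_apply _ MeasurableSet.univ, Measure.restrict_univ] at h1
  rw [integral_eq_lintegral_of_nonneg_ae (Eventually.of_forall fun y ↦ hK0 (y, r) ⟨mem_univ _, hr⟩)
    hc.aestronglyMeasurable, h1, ENNReal.toReal_one]

/-! ### Prop. 5.2 for the kernel, on `[r₁, r₂] ⊂ (a, t₀)` -/

include hh hR in
/-- **Prop. 5.2 for the conjugate heat kernel, first identity integrated**: for a Ricci flow on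
`[r₁, r₂]`, `a < r₁ < r₂ < t₀`, and the kernel `K = K(x₀,t₀;·,·)` (`C^∞`, `> 0`, density of
`ν_{x₀,t₀;s}`, `∂ₛK = −ΔK + RK` on `M × (a, t₀)`),
`(t₀ − r₁) 𝒩(r₁) − (t₀ − r₂) 𝒩(r₂) = ∫_{r₁}^{r₂} 𝒲[h(s), f(s), t₀ − s] ds`,
`𝒩(r) = pointedNashEntropy h (fun r y ↦ K (y, r)) m t₀ r = 𝒩_{x₀,t₀}(t₀ − r)`
(`IsRicciFlow.mul_pointedNashEntropy_sub_eq_integral` after time translation).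
[cite: Bamler2020Entropy, §5.1, Prop. 5.2] -/
theorem IsRicciFlow.mul_kernelNashEntropy_sub_eq_integral {a t₀ r₁ r₂ : ℝ} {x₀ : M}
    {K : M × ℝ → ℝ} (hflow : IsRicciFlow h cov (Icc r₁ r₂))
    (hKs : ContMDiffOn (I.prod 𝓘(ℝ, ℝ)) 𝓘(ℝ, ℝ) ∞ K (univ ×ˢ Ioo a t₀))
    (hKpos : ∀ p ∈ univ ×ˢ Ioo a t₀, 0 < K p)
    (hKν : ∀ s ∈ Ioo a t₀, heatKernelMeasure hh hR t₀ x₀ s =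
      (h s).riemVolume.withDensity fun y ↦ ENNReal.ofReal (K (y, s)))
    (hKpde : ∀ p ∈ univ ×ˢ Ioo a t₀, deriv (fun s ↦ K (p.1, s)) p.2 =
      -(h p.2).laplaceBeltrami (fun y ↦ K (y, p.2)) p.1 +
        (h p.2).scalarCurvatureWith (cov p.2) p.1 * K p)
    (har₁ : a < r₁) (h12 : r₁ < r₂) (hr₂ : r₂ < t₀) :
    (t₀ - r₁) * pointedNashEntropy h (fun r y ↦ K (y, r)) m t₀ r₁ -
        (t₀ - r₂) * pointedNashEntropy h (fun r y ↦ K (y, r)) m t₀ r₂ =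
      ∫ s in r₁..r₂, (h s).wEntropy (cov s) (entropyPotential (fun r y ↦ K (y, r)) m t₀ s)
        (t₀ - s) := by
  -- translate to `[0, r₂ - r₁]`
  set T' : ℝ := r₂ - r₁ with hT'def
  have hT' : 0 < T' := sub_pos.2 h12
  set u : ℝ → M → ℝ := fun r y ↦ K (y, r) with hu
  have hflow' : IsRicciFlow (fun r ↦ h (r + r₁)) (fun r ↦ cov (r + r₁)) (Icc 0 T') := by
    refine (hflow.comp_add_const r₁).mono fun r hr ↦ ?_
    exact ⟨by linarith [hr.1], by rw [hT'def] at hr; linarith [hr.2]⟩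
  have hR' : ∀ r ∈ Icc (0 : ℝ) T', (h (r + r₁)).IsRiemannian := fun r _ ↦ hR _
  have hsol : IsConjugateHeatSolutionOn h cov (Icc r₁ r₂) u :=
    isConjugateHeatSolutionOn_of_kernel hKs hKpde har₁ h12 hr₂
  have hsol' : IsConjugateHeatSolutionOn (fun r ↦ h (r + r₁)) (fun r ↦ cov (r + r₁)) (Icc 0 T')
      (fun r ↦ u (r + r₁)) := by
    simpa only [sub_self, hT'def] using hsol.comp_add_const h12 r₁
  have hmem : ∀ r ∈ Icc (0 : ℝ) T', r + r₁ ∈ Ioo a t₀ := fun r hr ↦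
    ⟨by linarith [hr.1], by rw [hT'def] at hr; linarith [hr.2]⟩
  have hpos' : ∀ r ∈ Icc (0 : ℝ) T', ∀ y, 0 < (fun r ↦ u (r + r₁)) r y := fun r hr y ↦
    hKpos (y, r + r₁) ⟨mem_univ _, hmem r hr⟩
  have hmass' : ∀ r ∈ Icc (0 : ℝ) T', ∫ y, (fun r ↦ u (r + r₁)) r y ∂(h (r + r₁)).riemVolume = 1 :=
    fun r hr ↦ integral_kernel_eq_one hh hR hKs (fun p hp ↦ (hKpos p hp).le) hKν (hmem r hr)
  have hτ₀' : T' < t₀ - r₁ := by rw [hT'def]; linarith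
  have key := hflow'.mul_pointedNashEntropy_sub_eq_integral hT' hR' hpos' hsol' hmass' hτ₀'
    (t₁ := 0) (t₂ := T') ⟨le_rfl, hT'.le⟩ ⟨hT'.le, le_rfl⟩ hT'.le
  rw [pointedNashEntropy_comp_add_const, pointedNashEntropy_comp_add_const] at key
  simp only [zero_add, sub_zero] at key
  have e1 : T' + r₁ = r₂ := by rw [hT'def]; ring
  have e2 : t₀ - r₁ - T' = t₀ - r₂ := by rw [hT'def]; ring
  rw [e1, e2] at key
  rw [key]
  -- the integrand is the translated `𝒲`
  have hW : (fun s ↦ (h (s + r₁)).wEntropy (cov (s + r₁))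
      (entropyPotential (fun r ↦ u (r + r₁)) m (t₀ - r₁) s) (t₀ - r₁ - s)) =
      fun s ↦ (fun s' ↦ (h s').wEntropy (cov s') (entropyPotential u m t₀ s') (t₀ - s')) (s + r₁) := by
    funext s
    simp only [entropyPotential_comp_add_const]
    rw [show t₀ - r₁ - s = t₀ - (s + r₁) by ring]
  rw [hW, intervalIntegral.integral_comp_add_right
    (fun s' ↦ (h s').wEntropy (cov s') (entropyPotential u m t₀ s') (t₀ - s')) r₁, zero_add, e1]

include hR in
omit [SecondCountableTopology M] in
/-- **`𝒲` of the kernel is non-decreasing in `s`** (Prop. 5.2, second identity integrated;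
Perelman's monotonicity): for a Ricci flow on `[b₁, b₂]`, `a < b₁ < b₂ < t₀`, and `K` as above,
`s ↦ 𝒲[h(s), f(s), t₀ − s]` is monotone on `[b₁, b₂]`.
[cite: Bamler2020Entropy, §5.1, Prop. 5.2] [cite: Perelman2002, §3.1, (3.4)] -/
theorem IsRicciFlow.monotoneOn_kernelWEntropy {a t₀ b₁ b₂ : ℝ} {K : M × ℝ → ℝ}
    (hflow : IsRicciFlow h cov (Icc b₁ b₂))
    (hKs : ContMDiffOn (I.prod 𝓘(ℝ, ℝ)) 𝓘(ℝ, ℝ) ∞ K (univ ×ˢ Ioo a t₀))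
    (hKpos : ∀ p ∈ univ ×ˢ Ioo a t₀, 0 < K p)
    (hKpde : ∀ p ∈ univ ×ˢ Ioo a t₀, deriv (fun s ↦ K (p.1, s)) p.2 =
      -(h p.2).laplaceBeltrami (fun y ↦ K (y, p.2)) p.1 +
        (h p.2).scalarCurvatureWith (cov p.2) p.1 * K p)
    (hab₁ : a < b₁) (hb : b₁ < b₂) (hb₂ : b₂ < t₀) :
    MonotoneOn (fun s ↦ (h s).wEntropy (cov s) (entropyPotential (fun r y ↦ K (y, r)) m t₀ s)
      (t₀ - s)) (Icc b₁ b₂) := by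
  set T' : ℝ := b₂ - b₁ with hT'def
  have hT' : 0 < T' := sub_pos.2 hb
  set u : ℝ → M → ℝ := fun r y ↦ K (y, r) with hu
  have hflow' : IsRicciFlow (fun r ↦ h (r + b₁)) (fun r ↦ cov (r + b₁)) (Icc 0 T') := by
    refine (hflow.comp_add_const b₁).mono fun r hr ↦ ?_
    exact ⟨by linarith [hr.1], by rw [hT'def] at hr; linarith [hr.2]⟩
  have hR' : ∀ r ∈ Icc (0 : ℝ) T', (h (r + b₁)).IsRiemannian := fun r _ ↦ hR _
  have hsol' : IsConjugateHeatSolutionOn (fun r ↦ h (r + b₁)) (fun r ↦ cov (r + b₁)) (Icc 0 T')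
      (fun r ↦ u (r + b₁)) := by
    simpa only [sub_self, hT'def] using
      (isConjugateHeatSolutionOn_of_kernel hKs hKpde hab₁ hb hb₂).comp_add_const hb b₁
  have hmem : ∀ r ∈ Icc (0 : ℝ) T', r + b₁ ∈ Ioo a t₀ := fun r hr ↦
    ⟨by linarith [hr.1], by rw [hT'def] at hr; linarith [hr.2]⟩
  have hpos' : ∀ r ∈ Icc (0 : ℝ) T', ∀ y, 0 < (fun r ↦ u (r + b₁)) r y := fun r hr y ↦
    hKpos (y, r + b₁) ⟨mem_univ _, hmem r hr⟩
  have hτ₀' : T' < t₀ - b₁ := by rw [hT'def]; linarith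
  have key := hflow'.monotoneOn_wEntropy_entropyPotential hT' hR' hpos' hsol' hτ₀'
  intro s₁ hs₁ s₂ hs₂ hle
  have h1 : s₁ - b₁ ∈ Icc (0 : ℝ) T' := ⟨by linarith [hs₁.1], by rw [hT'def]; linarith [hs₁.2]⟩
  have h2 : s₂ - b₁ ∈ Icc (0 : ℝ) T' := ⟨by linarith [hs₂.1], by rw [hT'def]; linarith [hs₂.2]⟩
  have k := key h1 h2 (by linarith)
  simp only [entropyPotential_comp_add_const, sub_add_cancel] at k
  rw [show t₀ - b₁ - (s₁ - b₁) = t₀ - s₁ by ring, show t₀ - b₁ - (s₂ - b₁) = t₀ - s₂ by ring] at k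
  exact k


include hh hR in
/-- **Concavity sandwich for `τ𝒩(τ)` of the kernel** (Prop. 5.2): for a Ricci flow on `[r₁, r₂]`,
`a < r₁ < r₂ < t₀`,
`(r₂ − r₁) 𝒲(r₁) ≤ (t₀ − r₁)𝒩(r₁) − (t₀ − r₂)𝒩(r₂) ≤ (r₂ − r₁) 𝒲(r₂)`.
[cite: Bamler2020Entropy, §5.1, Prop. 5.2] -/
theorem IsRicciFlow.mul_kernelWEntropy_le_and_le {a t₀ r₁ r₂ : ℝ} {x₀ : M}
    {K : M × ℝ → ℝ} (hflow : IsRicciFlow h cov (Icc r₁ r₂))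
    (hKs : ContMDiffOn (I.prod 𝓘(ℝ, ℝ)) 𝓘(ℝ, ℝ) ∞ K (univ ×ˢ Ioo a t₀))
    (hKpos : ∀ p ∈ univ ×ˢ Ioo a t₀, 0 < K p)
    (hKν : ∀ s ∈ Ioo a t₀, heatKernelMeasure hh hR t₀ x₀ s =
      (h s).riemVolume.withDensity fun y ↦ ENNReal.ofReal (K (y, s)))
    (hKpde : ∀ p ∈ univ ×ˢ Ioo a t₀, deriv (fun s ↦ K (p.1, s)) p.2 =
      -(h p.2).laplaceBeltrami (fun y ↦ K (y, p.2)) p.1 +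
        (h p.2).scalarCurvatureWith (cov p.2) p.1 * K p)
    (har₁ : a < r₁) (h12 : r₁ < r₂) (hr₂ : r₂ < t₀) :
    (r₂ - r₁) * (h r₁).wEntropy (cov r₁) (entropyPotential (fun r y ↦ K (y, r)) m t₀ r₁) (t₀ - r₁) ≤
        (t₀ - r₁) * pointedNashEntropy h (fun r y ↦ K (y, r)) m t₀ r₁ -
          (t₀ - r₂) * pointedNashEntropy h (fun r y ↦ K (y, r)) m t₀ r₂ ∧
      (t₀ - r₁) * pointedNashEntropy h (fun r y ↦ K (y, r)) m t₀ r₁ -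
          (t₀ - r₂) * pointedNashEntropy h (fun r y ↦ K (y, r)) m t₀ r₂ ≤
        (r₂ - r₁) * (h r₂).wEntropy (cov r₂) (entropyPotential (fun r y ↦ K (y, r)) m t₀ r₂)
          (t₀ - r₂) := by
  set W : ℝ → ℝ := fun s ↦ (h s).wEntropy (cov s) (entropyPotential (fun r y ↦ K (y, r)) m t₀ s)
    (t₀ - s) with hWdef
  rw [hflow.mul_kernelNashEntropy_sub_eq_integral hh hR hKs hKpos hKν hKpde har₁ h12 hr₂]
  have hmono : MonotoneOn W (Icc r₁ r₂) :=
    hflow.monotoneOn_kernelWEntropy hR hKs hKpos hKpde har₁ h12 hr₂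
  have hint : IntervalIntegrable W volume r₁ r₂ := (hmono.mono (by rw [uIcc_of_le h12.le])).intervalIntegrable
  constructor
  · have key := intervalIntegral.integral_mono_on (μ := volume) h12.le intervalIntegrable_const hint
      (fun s hs ↦ hmono (left_mem_Icc.2 h12.le) hs hs.1)
    rwa [intervalIntegral.integral_const, smul_eq_mul] at key
  · have key := intervalIntegral.integral_mono_on (μ := volume) h12.le hint intervalIntegrable_const
      (fun s hs ↦ hmono hs (right_mem_Icc.2 h12.le) hs.2)
    rwa [intervalIntegral.integral_const, smul_eq_mul] at key

include hh hR in
/-- **The entropy floor passes to the pointed Nash entropy of the kernel** (display after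
Prop. 5.2, finite-interval form): if `μ[h(s), t₀ − s] ≥ F` for `s ∈ [r₁, r₂]`, then
`(t₀ − r₂)𝒩(r₂) + (r₂ − r₁)F ≤ (t₀ − r₁)𝒩(r₁)` (`∫ 𝒲 ≥ ∫ μ ≥ (r₂ − r₁)F`,
`muEntropy_le_wEntropy_of_integral_eq_one`).
[cite: Bamler2020Entropy, §5.1, display after Prop. 5.2] -/
theorem IsRicciFlow.mul_kernelNashEntropy_add_mul_le {a t₀ r₁ r₂ : ℝ} {x₀ : M}
    {K : M × ℝ → ℝ} (hflow : IsRicciFlow h cov (Icc r₁ r₂))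
    (hKs : ContMDiffOn (I.prod 𝓘(ℝ, ℝ)) 𝓘(ℝ, ℝ) ∞ K (univ ×ˢ Ioo a t₀))
    (hKpos : ∀ p ∈ univ ×ˢ Ioo a t₀, 0 < K p)
    (hKν : ∀ s ∈ Ioo a t₀, heatKernelMeasure hh hR t₀ x₀ s =
      (h s).riemVolume.withDensity fun y ↦ ENNReal.ofReal (K (y, s)))
    (hKpde : ∀ p ∈ univ ×ˢ Ioo a t₀, deriv (fun s ↦ K (p.1, s)) p.2 =
      -(h p.2).laplaceBeltrami (fun y ↦ K (y, p.2)) p.1 +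
        (h p.2).scalarCurvatureWith (cov p.2) p.1 * K p)
    (har₁ : a < r₁) (h12 : r₁ < r₂) (hr₂ : r₂ < t₀) {F : ℝ}
    (hF : ∀ s ∈ Icc r₁ r₂, ((F : ℝ) : EReal) ≤ (h s).muEntropy (cov s) (t₀ - s)) :
    (t₀ - r₂) * pointedNashEntropy h (fun r y ↦ K (y, r)) m t₀ r₂ + (r₂ - r₁) * F ≤
      (t₀ - r₁) * pointedNashEntropy h (fun r y ↦ K (y, r)) m t₀ r₁ := by
  set W : ℝ → ℝ := fun s ↦ (h s).wEntropy (cov s) (entropyPotential (fun r y ↦ K (y, r)) m t₀ s)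
    (t₀ - s) with hWdef
  have hD := hflow.mul_kernelNashEntropy_sub_eq_integral hh hR hKs hKpos hKν hKpde har₁ h12 hr₂
  have hmono : MonotoneOn W (Icc r₁ r₂) :=
    hflow.monotoneOn_kernelWEntropy hR hKs hKpos hKpde har₁ h12 hr₂
  have hint : IntervalIntegrable W volume r₁ r₂ := (hmono.mono (by rw [uIcc_of_le h12.le])).intervalIntegrable
  have hsol : IsConjugateHeatSolutionOn h cov (Icc r₁ r₂) fun r y ↦ K (y, r) :=
    isConjugateHeatSolutionOn_of_kernel hKs hKpde har₁ h12 hr₂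
  have hWF : ∀ s ∈ Icc r₁ r₂, F ≤ W s := by
    intro s hs
    have hs' : s ∈ Ioo a t₀ := ⟨har₁.trans_le hs.1, hs.2.trans_lt hr₂⟩
    have hslice : ContMDiff I 𝓘(ℝ, ℝ) ∞ fun y ↦ K (y, s) :=
      contMDiff_slice_of_contMDiffOn (u := fun r y ↦ K (y, r)) hsol.1 hs
    have hμ := muEntropy_le_wEntropy_of_integral_eq_one (h s) (cov s) (u := fun y ↦ K (y, s))
      hslice (fun y ↦ hKpos (y, s) ⟨mem_univ _, hs'⟩)
      (integral_kernel_eq_one hh hR hKs (fun p hp ↦ (hKpos p hp).le) hKν hs') (τ := t₀ - s)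
      (by linarith [hs'.2])
    exact EReal.coe_le_coe_iff.1 ((hF s hs).trans hμ)
  have key := intervalIntegral.integral_mono_on (μ := volume) h12.le intervalIntegrable_const hint hWF
  rw [intervalIntegral.integral_const, smul_eq_mul] at key
  linarith

end Kernel

end Literature.Geometry.Riemannian

end
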